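import Summits.CriticalPhenomena.PercolationContinuityZ3.Theorems.PercLowPointHalfSpaceQuantitativeBGNWallDefs
import Summits.CriticalPhenomena.PercolationContinuityZ3.Theorems.PercLowPointHalfSpaceQuantitativeBGNWallBootstrapPrep
import Summits.CriticalPhenomena.PercolationContinuityZ3.Theorems.PercLowPointHalfSpaceQuantitativeBGNWallTransfer
import Literature.Probability.Percolation.TwoGhostInequalityProofs
import Mathlib.MeasureTheory.MeasurableSpace.NCard
import Mathlib.Data.Pi.Interval
import HarnessLib

/-!
# `QuantitativeBGN` (stmt-CriticalPhenomena-0913), line `longrange-wall-ghost-bootstrap` — K1, basics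

First part of the stub `stub_wallTwoGhost` (K1, the basic two-ghost inequality on the wall) of the
skeleton `Cruxes/QuantitativeBGN/Lines/longrange_wall_ghost_bootstrap.lean` (objects in
`Theorems/PercLowPointHalfSpaceQuantitativeBGNWallDefs.lean`, namespace `…Theorems.WallGhost`).
K1 is Hutchcroft's two-ghost inequality (Ann. Probab. 48 (2020), arXiv:1808.08940, §3) re-run for the
augmented model `augWall p λ α` (bulk bond percolation on `ℤ³` plus long wall bonds) with the group `ℤ²` of
wall translations and the wall FOOTPRINT as the size of a cluster; the tree template is
`Literature/Probability/Percolation/TwoGhostInequalityProofs.lean` (the same inequality on `ℤ^d`).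

This file fixes the vocabulary shared by all parts (namespace `…Theorems.WallTwoGhost`):

* `EH` (pairs of distinct points of `H = {0 ≤ x₀}`), `res ω = ω ∩ EH`, and the bridge
  `clusterH ω x = openCluster (res ω) x` (`x ∈ H`), with its consequences (symmetry, merging by an open
  wall bond, invariance of `C_H(a) ∪ C_H(b)` under flipping `{a,b}`, wall-shift covariance,
  wall-shift invariance of `augWall` in integral form);
* the integer footprint `footN ω x = |C_H(x) ∩ ∂H|` and the label sets of the wall bonds of type `x`
  touching `C_H(0)` (`labTouch`, counts `nAll`, `nSt`), the fluctuation statistic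
  `Zc = Σ_{x∈s} c_x (#open - q_x #all)` of the exploration martingale, and their measurability;
* the truncated step graphs `trG L` (lattice edges inside `H` and wall pairs of sup-distance `≤ L`;
  locally finite) used to run the tree's `ClusterExploration`.
-/

noncomputable section

namespace Summit.CriticalPhenomena.PercolationContinuityZ3.Theorems

open MeasureTheory Filter Literature.Probability.Percolation Literature.Probability.LatticeModels
open Summit.CriticalPhenomena.PercolationContinuityZ3.Theorems.WallGhost
open scoped ENNReal

namespace WallTwoGhost
/-! ### Pairs inside the half-space; `clusterH` as an ordinary open cluster -/

/-- `EH`: the unordered pairs of DISTINCT points of the half-space `H = {x | 0 ≤ x₀}` (the edge set of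
the complete step graph inside `H`). [folklore] -/
def EH : Set (Sym2 (Site 3)) := (withinGraph ⊤ {y : Site 3 | 0 ≤ y 0}).edgeSet

/-- Membership of a concrete pair in `EH`. [folklore] -/
theorem mk_mem_EH {u v : Site 3} : s(u, v) ∈ EH ↔ u ≠ v ∧ 0 ≤ u 0 ∧ 0 ≤ v 0 := by
  rw [EH, mem_edgeSet_withinGraph, SimpleGraph.top_adj]
  rfl

/-- Restriction of a configuration to the pairs inside `H`. [folklore] -/
def res (ω : BondConfig (Site 3)) : BondConfig (Site 3) := ω ∩ EH

/-- Membership in the restricted configuration. [folklore] -/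
theorem mem_res {ω : BondConfig (Site 3)} {e : Sym2 (Site 3)} : e ∈ res ω ↔ e ∈ ω ∧ e ∈ EH := Iff.rfl

/-- **Bridge**: for `x ∈ H`, `C_H(x)` is the ordinary open cluster of `x` in the restricted
configuration `ω ∩ EH`. [folklore] -/
theorem clusterH_eq {x : Site 3} (hx : 0 ≤ x 0) (ω : BondConfig (Site 3)) :
    clusterH ω x = openCluster (res ω) x := by
  ext v
  rw [mem_clusterH, openConnIn_eq_openConnVia (S := {y : Site 3 | 0 ≤ y 0}) hx]
  rfl

/-- `C_H(x) ⊆ H`. [folklore] -/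
theorem nonneg_of_mem_clusterH {ω : BondConfig (Site 3)} {x v : Site 3} (hv : v ∈ clusterH ω x) :
    0 ≤ v 0 := hv.2.1

/-- The root of a nonempty `H`-cluster lies in `H`. [folklore] -/
theorem nonneg_of_mem_clusterH' {ω : BondConfig (Site 3)} {x v : Site 3} (hv : v ∈ clusterH ω x) :
    0 ≤ x 0 := hv.1

/-- `x ∈ C_H(x)` for `x ∈ H`. [folklore] -/
theorem self_mem_clusterH {x : Site 3} (hx : 0 ≤ x 0) (ω : BondConfig (Site 3)) : x ∈ clusterH ω x := by
  rw [clusterH_eq hx]; exact mem_openCluster_self _ x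

/-- `H`-clusters are classes: `v ∈ C_H(x) → C_H(v) = C_H(x)`. [folklore] -/
theorem clusterH_eq_of_mem {ω : BondConfig (Site 3)} {x v : Site 3} (hv : v ∈ clusterH ω x) :
    clusterH ω v = clusterH ω x := by
  have hx := nonneg_of_mem_clusterH' hv
  have hv0 := nonneg_of_mem_clusterH hv
  rw [clusterH_eq hx] at hv ⊢
  rw [clusterH_eq hv0]
  exact TwoGhost.openCluster_eq_of_mem hv

/-- Symmetry: `v ∈ C_H(x) ↔ x ∈ C_H(v)`. [folklore] -/
theorem mem_clusterH_comm {ω : BondConfig (Site 3)} {x v : Site 3} : v ∈ clusterH ω x ↔ x ∈ clusterH ω v := by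
  constructor
  · intro hv
    rw [clusterH_eq_of_mem hv]
    exact self_mem_clusterH (nonneg_of_mem_clusterH' hv) ω
  · intro hx
    rw [clusterH_eq_of_mem hx]
    exact self_mem_clusterH (nonneg_of_mem_clusterH' hx) ω

/-- An open pair inside `H` merges the `H`-clusters of its endpoints. [folklore] -/
theorem clusterH_eq_of_mk_mem {ω : BondConfig (Site 3)} {a b : Site 3} (ha : 0 ≤ a 0) (hb : 0 ≤ b 0)
    (hab : a ≠ b) (h : s(a, b) ∈ ω) : clusterH ω b = clusterH ω a := by
  rw [clusterH_eq ha, clusterH_eq hb]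
  exact TwoGhost.openCluster_eq_of_mk_mem hab ⟨h, mk_mem_EH.2 ⟨hab, ha, hb⟩⟩

/-- Restriction commutes with closing one pair. [folklore] -/
theorem res_diff (ω : BondConfig (Site 3)) (e : Sym2 (Site 3)) : res (ω \ {e}) = res ω \ {e} := by
  ext f; simp only [mem_res, Set.mem_sdiff, Set.mem_singleton_iff]; tauto

/-- **Flipping the pair `{a,b}` does not change `C_H(a) ∪ C_H(b)`** (`a, b ∈ H`).
[cite: Hutchcroft2020Locality, §3, proof of Lemma 3.1] -/
theorem union_clusterH_diff_eq {a b : Site 3} (ha : 0 ≤ a 0) (hb : 0 ≤ b 0) (ω : BondConfig (Site 3)) :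
    clusterH (ω \ {s(a, b)}) a ∪ clusterH (ω \ {s(a, b)}) b = clusterH ω a ∪ clusterH ω b := by
  simp only [clusterH_eq ha, clusterH_eq hb, res_diff]
  exact TwoGhost.union_openCluster_diff_eq_self (res ω) a b

/-! ### Wall translations -/

/-- `EH` is invariant under wall translations. [folklore] -/
theorem map_add_mem_EH_iff {t : Site 3} (ht : t 0 = 0) (e : Sym2 (Site 3)) :
    Sym2.map (· + t) e ∈ EH ↔ e ∈ EH := by
  induction e using Sym2.ind with
  | h u v => simp [mk_mem_EH, ht]

/-- Restriction commutes with wall translations. [folklore] -/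
theorem res_shiftConfig {t : Site 3} (ht : t 0 = 0) (ω : BondConfig (Site 3)) :
    res (TwoGhost.shiftConfig t ω) = TwoGhost.shiftConfig t (res ω) := by
  ext e
  rw [mem_res, TwoGhost.shiftConfig_apply, TwoGhost.shiftConfig_apply]
  constructor
  · rintro ⟨⟨f, hf, rfl⟩, hE⟩
    exact ⟨f, ⟨hf, (map_add_mem_EH_iff ht f).1 hE⟩, rfl⟩
  · rintro ⟨f, ⟨hf, hE⟩, rfl⟩
    exact ⟨⟨f, hf, rfl⟩, (map_add_mem_EH_iff ht f).2 hE⟩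

/-- **Wall-shift covariance of `H`-clusters**: `C_H^{ω+t}(x + t) = C_H^ω(x) + t` (`x ∈ H`, `t ∈ ∂H`).
[folklore] -/
theorem clusterH_shiftConfig {t : Site 3} (ht : t 0 = 0) {x : Site 3} (hx : 0 ≤ x 0) (ω : BondConfig (Site 3)) :
    clusterH (TwoGhost.shiftConfig t ω) (x + t) = (· + t) '' clusterH ω x := by
  have hxt : 0 ≤ (x + t) 0 := by simp [ht, hx]
  rw [clusterH_eq hxt, clusterH_eq hx, res_shiftConfig ht, TwoGhost.openCluster_shiftConfig]

/-- Membership form of the covariance. [folklore] -/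
theorem add_mem_clusterH_shiftConfig_iff {t : Site 3} (ht : t 0 = 0) {x : Site 3} (hx : 0 ≤ x 0)
    (ω : BondConfig (Site 3)) (v : Site 3) :
    v + t ∈ clusterH (TwoGhost.shiftConfig t ω) (x + t) ↔ v ∈ clusterH ω x := by
  rw [clusterH_shiftConfig ht hx]
  exact (add_left_injective t).mem_set_image

/-- **Wall-shift invariance of the augmented model** (integral form): the parameters `augProb` are
invariant under wall translations (`WallBootstrap.augProb_shift`), hence so is the product measure.
[folklore] -/
theorem lintegral_shiftConfig (p : unitInterval) (lam α : ℝ) {t : Site 3} (ht : t 0 = 0)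
    (f : BondConfig (Site 3) → ℝ≥0∞) :
    ∫⁻ ω, f (TwoGhost.shiftConfig t ω) ∂(augWall p lam α) = ∫⁻ ω, f ω ∂(augWall p lam α) := by
  rw [← lintegral_map_equiv f (TwoGhost.shiftConfig t)]
  congr 1
  exact prodBernoulli_map_image_equiv (augProb p lam α) (sym2Equiv (Site.shift t))
    (fun e => WallBootstrap.augProb_shift p lam α ht e)

/-- The probability of the wall bond `{u, u + x}` is that of `{0, x}` (`u ∈ ∂H`). [folklore] -/
theorem augProb_mk_add (p : unitInterval) (lam α : ℝ) {u : Site 3} (hu : u 0 = 0) (x : Site 3) :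
    augProb p lam α s(u, u + x) = augProb p lam α s((0 : Site 3), x) := by
  have := WallBootstrap.augProb_shift p lam α hu s((0 : Site 3), x)
  rw [sym2Equiv_mk, Site.shift_apply, Site.shift_apply, zero_add, add_comm x u] at this
  exact this

/-! ### The integer footprint -/

/-- `F_x = |C_H(x) ∩ ∂H|` as a natural number (`0` for an infinite footprint). [folklore] -/
def footN (ω : BondConfig (Site 3)) (x : Site 3) : ℕ := (clusterH ω x ∩ {v | v 0 = 0}).ncard

/-- For a finite `H`-cluster, `footAt = footN`. [folklore] -/
theorem footAt_eq_footN {ω : BondConfig (Site 3)} {x : Site 3} (h : (clusterH ω x).Finite) :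
    footAt ω x = footN ω x := by
  rw [footAt, footN, (h.subset Set.inter_subset_left).cast_ncard_eq]

/-- A wall vertex has footprint `≥ 1` (when its `H`-cluster is finite). [folklore] -/
theorem one_le_footN {ω : BondConfig (Site 3)} {x : Site 3} (hx : x 0 = 0) (h : (clusterH ω x).Finite) :
    1 ≤ footN ω x := by
  rw [footN, Nat.one_le_iff_ne_zero, Ne, Set.ncard_eq_zero (h.subset Set.inter_subset_left)]
  intro h0
  have : x ∈ clusterH ω x ∩ {v | v 0 = 0} := ⟨self_mem_clusterH (le_of_eq hx.symm) ω, hx⟩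
  rw [h0] at this
  exact this

/-- Wall translations preserve footprints. [folklore] -/
theorem footN_shiftConfig {t : Site 3} (ht : t 0 = 0) {x : Site 3} (hx : 0 ≤ x 0) (ω : BondConfig (Site 3)) :
    footN (TwoGhost.shiftConfig t ω) (x + t) = footN ω x := by
  have hW : (· + t) '' ({v : Site 3 | v 0 = 0}) = {v | v 0 = 0} := by
    ext v
    constructor
    · rintro ⟨w, hw, rfl⟩; simpa [ht] using hw
    · intro hv; exact ⟨v - t, by simpa [ht] using hv, by simp⟩
  rw [footN, footN, clusterH_shiftConfig ht hx]
  conv_lhs => rw [← hW, ← Set.image_inter (add_left_injective t), Set.ncard_image_of_injective _ (add_left_injective t)]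

/-- Wall translations preserve finiteness of `H`-clusters. [folklore] -/
theorem finite_clusterH_shiftConfig_iff {t : Site 3} (ht : t 0 = 0) {x : Site 3} (hx : 0 ≤ x 0)
    (ω : BondConfig (Site 3)) :
    (clusterH (TwoGhost.shiftConfig t ω) (x + t)).Finite ↔ (clusterH ω x).Finite := by
  rw [clusterH_shiftConfig ht hx]
  exact Set.finite_image_iff (add_left_injective t).injOn

/-! ### Measurability of cluster statistics -/

/-- `{v ∈ C_H(x)}` is measurable. [folklore] -/
theorem measurableSet_mem_clusterH (x v : Site 3) :
    MeasurableSet {ω : BondConfig (Site 3) | v ∈ clusterH ω x} :=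
  measurableSet_openConnIn_of_countable _ x v

/-- `{C_H(x) finite}` is measurable. [folklore] -/
theorem measurableSet_finite_clusterH (x : Site 3) :
    MeasurableSet {ω : BondConfig (Site 3) | (clusterH ω x).Finite} := by
  have : {ω : BondConfig (Site 3) | (clusterH ω x).Finite} =
      (fun ω => (clusterH ω x).encard) ⁻¹' {m : ℕ∞ | m < ⊤} := by
    ext ω; simp [Set.encard_lt_top_iff]
  rw [this]
  exact (measurable_encard.comp (WallBootstrap.measurable_clusterH x)) (MeasurableSet.of_discrete)

/-- `footN · x` is measurable. [folklore] -/
theorem measurable_footN (x : Site 3) : Measurable fun ω : BondConfig (Site 3) => footN ω x := by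
  refine measurable_ncard.comp (measurable_set_iff.2 fun v => ?_)
  exact (measurable_set_iff.1 (WallBootstrap.measurable_clusterH x) v).and measurable_const

/-- Functions of a measurable event and a measurable `ℕ`-valued statistic are measurable. [folklore] -/
theorem measurable_ite_nat {β : Type*} [MeasurableSpace β] {P : BondConfig (Site 3) → Prop}
    [DecidablePred P] (hP : MeasurableSet {ω | P ω}) {f : BondConfig (Site 3) → ℕ} (hf : Measurable f)
    (φ : ℕ → β) (c : β) : Measurable fun ω => if P ω then φ (f ω) else c :=
  Measurable.ite hP ((measurable_from_nat (f := φ)).comp hf) measurable_const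

/-! ### Labels of the wall bonds of type `x` touching `C_H(0)` and the fluctuation statistic -/

/-- The wall vertices `u` whose bond of type `x`, `{u, u + x}`, touches `C_H(0)`. [folklore] -/
def labTouch (ω : BondConfig (Site 3)) (x : Site 3) : Set (Site 3) :=
  {u | u 0 = 0 ∧ (u ∈ clusterH ω 0 ∨ u + x ∈ clusterH ω 0)}

/-- Membership in `labTouch`. [folklore] -/
theorem mem_labTouch {ω : BondConfig (Site 3)} {x u : Site 3} :
    u ∈ labTouch ω x ↔ u 0 = 0 ∧ (u ∈ clusterH ω 0 ∨ u + x ∈ clusterH ω 0) := Iff.rfl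

/-- The number of wall bonds of type `x` touching `C_H(0)` (`0` if infinite). [folklore] -/
def nAll (ω : BondConfig (Site 3)) (x : Site 3) : ℕ := (labTouch ω x).ncard

/-- The number of wall bonds of type `x` touching `C_H(0)` in state `b` (`true` = open). [folklore] -/
def nSt (b : Bool) (ω : BondConfig (Site 3)) (x : Site 3) : ℕ :=
  {u ∈ labTouch ω x | (s(u, u + x) ∈ ω ↔ b = true)}.ncard

/-- A finite `H`-cluster is touched by finitely many bonds of a given type. [folklore] -/
theorem labTouch_finite {ω : BondConfig (Site 3)} (h : (clusterH ω 0).Finite) (x : Site 3) :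
    (labTouch ω x).Finite := by
  refine (h.union (h.image fun v => v - x)).subset ?_
  rintro u ⟨-, hu | hu⟩
  · exact Or.inl hu
  · exact Or.inr ⟨u + x, hu, by simp⟩

/-- Open plus closed bonds are all bonds (finite cluster). [folklore] -/
theorem nSt_true_add_false {ω : BondConfig (Site 3)} (h : (clusterH ω 0).Finite) (x : Site 3) :
    nSt true ω x + nSt false ω x = nAll ω x := by
  have hfin := labTouch_finite h x
  rw [nSt, nSt, nAll, ← Set.ncard_union_eq (Set.disjoint_left.2 fun u h1 h2 => ?_)
    (hfin.subset fun u hu => hu.1) (hfin.subset fun u hu => hu.1)]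
  · congr 1
    ext u
    simp only [Set.mem_union, Set.mem_setOf_eq, Bool.false_eq_true, iff_false, iff_true]
    tauto
  · simp only [Set.mem_setOf_eq, iff_true, Bool.false_eq_true, iff_false] at h1 h2
    exact h2.2 h1.2

/-- The counts through any finset enumerating the labels. [folklore] -/
theorem nAll_eq_card {ω : BondConfig (Site 3)} {x : Site 3} {U : Finset (Site 3)}
    (hU : (↑U : Set (Site 3)) = labTouch ω x) : nAll ω x = U.card := by
  rw [nAll, ← hU, Set.ncard_coe_finset]

/-- The state counts through any finset enumerating the labels. [folklore] -/
theorem nSt_eq_card {ω : BondConfig (Site 3)} [DecidablePred (· ∈ ω)] {x : Site 3} {U : Finset (Site 3)}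
    (hU : (↑U : Set (Site 3)) = labTouch ω x) (b : Bool) :
    nSt b ω x = (U.filter fun u => (s(u, u + x) ∈ ω ↔ b = true)).card := by
  rw [nSt, ← Set.ncard_coe_finset, Finset.coe_filter, ← hU]
  rfl

/-- **An open wall bond touching `C_H(0)` has its tail in `C_H(0)`**, so the open bonds of type
`x ≠ 0` touching a finite `C_H(0)` number at most `F = |C_H(0) ∩ ∂H|`. [folklore] -/
theorem nSt_true_le_footN {ω : BondConfig (Site 3)} (h : (clusterH ω 0).Finite) {x : Site 3}
    (hx0 : x 0 = 0) (hx : x ≠ 0) : nSt true ω x ≤ footN ω 0 := by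
  refine Set.ncard_le_ncard (fun u hu => ?_) (h.subset Set.inter_subset_left)
  simp only [Set.mem_setOf_eq, iff_true] at hu
  obtain ⟨⟨hu0, hC⟩, hop⟩ := hu
  refine ⟨?_, hu0⟩
  rcases hC with hC | hC
  · exact hC
  · have hux : (u + x) 0 = 0 := by simp [hu0, hx0]
    have hne : u ≠ u + x := fun h' => hx (by simpa using h'.symm)
    have := clusterH_eq_of_mk_mem (le_of_eq hu0.symm) (le_of_eq hux.symm) hne hop
    rw [← clusterH_eq_of_mem hC, this]
    exact self_mem_clusterH (le_of_eq hu0.symm) ω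

/-- **The fluctuation statistic** of the wall-bond exploration martingale with weights `c` on the
finite type set `s`: `Z^c = Σ_{x∈s} c_x (#{open bonds of type x touching C_H(0)} - q_x #{bonds of
type x touching C_H(0)})` (meaningful when `C_H(0)` is finite).
[cite: Hutchcroft2020Locality, §3, proof of Thm. 1.6 (the martingale Z)] -/
def Zc (p : unitInterval) (lam α : ℝ) (c : Site 3 → ℝ) (s : Finset (Site 3)) (ω : BondConfig (Site 3)) : ℝ :=
  ∑ x ∈ s, c x * ((nSt true ω x : ℝ) - wallBondProb p lam α x * nAll ω x)

/-- `labTouch · x` is a measurable set-valued map. [folklore] -/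
theorem measurable_labTouch (x : Site 3) : Measurable fun ω : BondConfig (Site 3) => labTouch ω x := by
  refine measurable_set_iff.2 fun u => measurableSet_setOf.1 ?_
  change MeasurableSet {ω : BondConfig (Site 3) | u 0 = 0 ∧ (u ∈ clusterH ω 0 ∨ u + x ∈ clusterH ω 0)}
  exact (MeasurableSet.const _).inter ((measurableSet_mem_clusterH 0 u).union (measurableSet_mem_clusterH 0 _))

/-- `nAll · x` is measurable. [folklore] -/
theorem measurable_nAll (x : Site 3) : Measurable fun ω : BondConfig (Site 3) => nAll ω x :=
  measurable_ncard.comp (measurable_labTouch x)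

/-- One-pair state events are measurable. [folklore] -/
theorem measurableSet_mem_iff_bool (e : Sym2 (Site 3)) (b : Bool) :
    MeasurableSet {ω : BondConfig (Site 3) | (e ∈ ω ↔ b = true)} := by
  cases b
  · have : {ω : BondConfig (Site 3) | (e ∈ ω ↔ false = true)} = {ω | e ∉ ω} := by ext ω; simp
    rw [this]; exact measurableSet_notMem _
  · have : {ω : BondConfig (Site 3) | (e ∈ ω ↔ true = true)} = {ω | e ∈ ω} := by ext ω; simp
    rw [this]; exact measurableSet_mem _

/-- `nSt b · x` is measurable. [folklore] -/
theorem measurable_nSt (b : Bool) (x : Site 3) : Measurable fun ω : BondConfig (Site 3) => nSt b ω x := by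
  refine measurable_ncard.comp (measurable_set_iff.2 fun u => measurableSet_setOf.1 ?_)
  have h1 : MeasurableSet {ω : BondConfig (Site 3) | u ∈ labTouch ω x} :=
    measurableSet_setOf.2 (measurable_set_iff.1 (measurable_labTouch x) u)
  exact h1.inter (measurableSet_mem_iff_bool (s(u, u + x)) b)

/-- `Z^c` is measurable. [folklore] -/
theorem measurable_Zc (p : unitInterval) (lam α : ℝ) (c : Site 3 → ℝ) (s : Finset (Site 3)) :
    Measurable (Zc p lam α c s) := by
  refine Finset.measurable_sum s fun x _ => Measurable.const_mul (Measurable.sub ?_ (Measurable.const_mul ?_ _)) _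
  · exact (measurable_from_nat (f := fun k : ℕ => (k : ℝ))).comp (measurable_nSt true x)
  · exact (measurable_from_nat (f := fun k : ℕ => (k : ℝ))).comp (measurable_nAll x)


end WallTwoGhost

open WallTwoGhost in
/-- **K1, part 1 (basics).** Flipping the pair `{a,b}` (`a, b ∈ H`) does not change `C_H(a) ∪ C_H(b)`:
the fact behind the resampling step of the AKN exchange in the wall two-ghost inequality.
[cite: Hutchcroft2020Locality, §3, proof of Lemma 3.1] -/
theorem wallTwoGhost_flip : ∀ (a b : Site 3), 0 ≤ a 0 → 0 ≤ b 0 → ∀ ω : BondConfig (Site 3), clusterH (ω \ {s(a, b)}) a ∪ clusterH (ω \ {s(a, b)}) b = clusterH ω a ∪ clusterH ω b :=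
  fun _ _ ha hb ω => union_clusterH_diff_eq ha hb ω

end Summit.CriticalPhenomena.PercolationContinuityZ3.Theorems
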